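import Mathlib.Analysis.SpecialFunctions.Gaussian.FourierTransform
import Mathlib.MeasureTheory.Integral.Pi
import Mathlib.MeasureTheory.Measure.Lebesgue.Complex
import Mathlib.MeasureTheory.Integral.Bochner.Basic
import HarnessLib

/-!
# The finite-volume lattice `φ⁴` (soft two-component / XY-type) Gibbs measure on the discrete torus

Definition request `defn-LatticePhi4Gibbs` (route AtomisticToContinuum/BECThermalWindow, crux
`ClassicalWindowReduction` and the Fröhlich–Simon–Spencer cite fact).  The classical lattice field
of Fröhlich–Simon–Spencer 1976 (phase transitions for the `(φ·φ)²` lattice models and the classical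
Heisenberg models in `d ≥ 3`, §3–4) in the general framework of Fröhlich–Israel–Lieb–Simon 1978 §3
(a copy of a configuration space with an a priori single-site measure `dϱ` at each site of a torus
`Λ`, nearest-neighbour coupling, Gibbs state `Z⁻¹ e^{−βH} ∏ dϱ`), for two-component spins
`φ_x ∈ ℂ ≅ ℝ²` with the absolutely continuous single-site weight `e^{−w(|φ|²)} d²φ`, on the discrete torus
`(ℤ/nℤ)^d` realised as `Fin d → Fin n` with the periodic shifts `x + e_k = x + Pi.single k 1`
(addition in `Fin n` wraps around), with the `φ⁴` single-site weight:

  `S(φ) = K ∑_x ∑_{k<d} ‖φ(x + e_k) − φ(x)‖² + K' ∑_x (‖φ x‖² − 1)²`,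
  `dμ(φ) = Z⁻¹ e^{−S(φ)} ∏_x d²φ_x`,  `Z = ∫ e^{−S(φ)} ∏_x d²φ_x`,

`K > 0` the stiffness, `K' > 0` the radial pinning (for `K' = 0` the weight is not normalisable:
constant fields have zero action).  Everything is a finite-dimensional Lebesgue integral
(`MeasureTheory.MeasureSpace.pi` over `Complex.measureSpace`).

## Contents (definitions with bodies + proved API; no named facts)

* `LatticePhi4.Config d n = (Fin d → Fin n) → ℂ`; `gradSq` (the periodic kinetic term),
  `radialAction K w` (general single-site radial weight `w(‖φ_x‖²)`, the FSS class),
  `phi4Weight K' r = K'(r − 1)²`, `phi4Action K K'` (`= radialAction K (phi4Weight K')`,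
  `phi4Action_eq` is the displayed formula); the Dirichlet-wall variant `dirichletGradSq`,
  `dirichletPhi4Action` (the field is `0` outside the cube `{0,…,n−1}^d`: forward bonds leaving
  the cube and the bonds entering it through the face `x_k = 0` contribute `‖φ_x‖²`).
* For an arbitrary action `S` on a measure space: `partitionFunction S = ∫ e^{−S}`,
  `gibbsMeasure S = Z⁻¹ · e^{−S} · volume`, `expect S F = ∫ F dμ_S`; PROVED:
  `isProbabilityMeasure_gibbsMeasure` (from integrability of `e^{−S}`).
* The three Gibbs measures `latticePhi4Gibbs d n K K'`, `latticeRadialGibbs d n K w`,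
  `latticePhi4DirichletGibbs d n K K'`; observables `twoPoint μ x y = ∫ conj(φ x) φ y dμ` and the
  long-range-order parameter `lroParameter μ = n^{−2d} ∑_x ∑_y Re ∫ conj(φ x) φ y dμ`.
* PROVED analysis: `integrable_exp_neg_radialAction` — for `K ≥ 0`, a continuous nonnegative
  kinetic term and a continuous single-site weight with LINEAR COERCIVITY `w(r) ≥ b r − a`
  (`b > 0`), `e^{−S}` is Lebesgue integrable (domination by the product Gaussian
  `∏_x e^{a} e^{−b‖φ_x‖²}`); hence `0 < Z` (`partitionFunction_pos`) and the three measures are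
  probability measures for `K ≥ 0`, `K' > 0` (`phi4Weight_coercive`: `K'(r−1)² ≥ (K'/2) r − K'`):
  `isProbabilityMeasure_latticePhi4Gibbs`, `…RadialGibbs`, `…Phi4DirichletGibbs`.

## Design notes

* Sites are `Fin d → Fin n` with `[NeZero n]` (so that `1 : Fin n` and `Pi.single k 1` exist), as
  the requesting route writes them; the tree's Ising torus uses `Fin d → ZMod n`
  (`LatticeGraph.TorusSite`), which is not definitionally `Fin n` for variable `n` — a bridge is a
  separate matter.  For `n = 1, 2` the "torus" degenerates (every shift is the identity, resp. the
  two bonds `x ∼ x ± e_k` coincide and are both counted by the ordered sum `∑_x ∑_k`); the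
  definitions make sense but FSS-type statements will want `3 ≤ n` or `Even n`.
* `Z` is a real Bochner integral: "`Z < ∞`" is the integrability statement
  `integrable_exp_neg_phi4Action`, "`Z > 0`" is `partitionFunction_pos`.
* Nothing is asserted about infinite volume, reflection positivity or infrared bounds here.

## References

* J. Fröhlich, B. Simon, T. Spencer, *Infrared bounds, phase transitions and continuous symmetry
  breaking*, Comm. Math. Phys. 50 (1976) 79–95, §3–4 (cite-only here, acq-01413: the `(φ·φ)²`
  lattice models and the classical Heisenberg models). [FrohlichSimonSpencer1976]
* J. Fröhlich, R. Israel, E. H. Lieb, B. Simon, *Phase transitions and reflection positivity. I*,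
  Comm. Math. Phys. 62 (1978) 1–34, §3 "general framework" (read in E. H. Lieb, *Statistical
  Mechanics* (Selecta), pp. 194, 200–203: configuration space `K^Λ`, a priori measure `∏ dϱ`,
  Gibbs states with periodic and general boundary conditions). [FrohlichIsraelLiebSimon1978]
-/

noncomputable section

open MeasureTheory Complex Finset
open scoped ENNReal ComplexConjugate

namespace Literature.Probability.LatticeModels

/-! ### Gibbs measures of an action on a measure space -/

section General

variable {X : Type*} [MeasureSpace X]

/-- The partition function `Z = ∫ e^{−S(φ)} dφ` of an action `S` (Bochner integral against
`volume`; it is the junk value `0` when `e^{−S}` is not integrable).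
[cite: FrohlichIsraelLiebSimon1978, §3 (Gibbs state, normalisation)] -/
def partitionFunction (S : X → ℝ) : ℝ := ∫ φ, Real.exp (-S φ)

/-- The finite-volume Gibbs measure `Z⁻¹ e^{−S} · dφ` of an action `S`.
[cite: FrohlichIsraelLiebSimon1978, §3 (Gibbs state Z⁻¹ e^{-βH} ∏ dϱ)] -/
def gibbsMeasure (S : X → ℝ) : Measure X :=
  (ENNReal.ofReal (partitionFunction S))⁻¹ •
    volume.withDensity fun φ ↦ ENNReal.ofReal (Real.exp (-S φ))

/-- The expectation `⟨F⟩_S = ∫ F dμ_S` of a complex observable. [cite: FrohlichIsraelLiebSimon1978, §3 (the state ⟨·⟩)] -/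
def expect (S : X → ℝ) (F : X → ℂ) : ℂ := ∫ φ, F φ ∂gibbsMeasure S

/-- The partition function is positive as soon as `e^{−S}` is integrable (and the space is not
null). [folklore] -/
theorem partitionFunction_pos [NeZero (volume : Measure X)] {S : X → ℝ}
    (hS : Integrable fun φ ↦ Real.exp (-S φ)) : 0 < partitionFunction S :=
  integral_exp_pos hS

/-- **The Gibbs measure is a probability measure** when `e^{−S}` is integrable (on a non-null
space). [cite: FrohlichIsraelLiebSimon1978, §3 (Gibbs state, normalisation)] -/
theorem isProbabilityMeasure_gibbsMeasure [NeZero (volume : Measure X)] {S : X → ℝ}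
    (hS : Integrable fun φ ↦ Real.exp (-S φ)) : IsProbabilityMeasure (gibbsMeasure S) := by
  have hZ : 0 < partitionFunction S := partitionFunction_pos hS
  have hlin : ∫⁻ φ, ENNReal.ofReal (Real.exp (-S φ)) = ENNReal.ofReal (partitionFunction S) := by
    rw [partitionFunction, ofReal_integral_eq_lintegral_ofReal hS
      (Filter.Eventually.of_forall fun φ ↦ (Real.exp_pos _).le)]
  refine ⟨?_⟩
  rw [gibbsMeasure, Measure.smul_apply, withDensity_apply _ MeasurableSet.univ,
    Measure.restrict_univ, hlin, smul_eq_mul,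
    ENNReal.inv_mul_cancel (by simpa using hZ) ENNReal.ofReal_ne_top]

end General

/-! ### The lattice: configurations and single-site weights -/

namespace LatticePhi4

variable {d n : ℕ}

/-- Field configurations `φ : (ℤ/nℤ)^d → ℂ` on the discrete torus (or cube) of side `n`, sites
written as `Fin d → Fin n`. [cite: FrohlichIsraelLiebSimon1978, §3 (configuration space K^Λ on the torus Λ)] -/
abbrev Config (d n : ℕ) : Type := (Fin d → Fin n) → ℂ

/-- The `φ⁴` single-site weight `w(r) = K'(r − 1)²` (radial pinning at `‖φ‖ = 1`).
[cite: FrohlichSimonSpencer1976, §3–4 ((φ·φ)² lattice models)] -/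
def phi4Weight (K' : ℝ) (r : ℝ) : ℝ := K' * (r - 1) ^ 2

/-- `φ⁴` coercivity: `K'(r − 1)² ≥ (K'/2) r − K'` for all real `r` (`K' ≥ 0`). [folklore] -/
theorem phi4Weight_coercive {K' : ℝ} (hK' : 0 ≤ K') (r : ℝ) :
    K' / 2 * r - K' ≤ phi4Weight K' r := by
  unfold phi4Weight
  nlinarith [sq_nonneg (r - 5 / 4), hK']

/-- The `φ⁴` weight is continuous. [folklore] -/
theorem continuous_phi4Weight (K' : ℝ) : Continuous (phi4Weight K') := by
  unfold phi4Weight; fun_prop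

/-! ### Normalisability: `e^{−S}` is integrable for coercive single-site weights -/

/-- The one-site Gaussian `e^{−b|z|²}` is integrable on `ℂ` (`b > 0`). [folklore] -/
theorem integrable_exp_neg_mul_normSq {b : ℝ} (hb : 0 < b) :
    Integrable fun z : ℂ ↦ Real.exp (-b * ‖z‖ ^ 2) := by
  have h := GaussianFourier.integrable_cexp_neg_mul_sq_norm_add (V := ℂ) (b := b)
    (by simpa using hb) 0 0
  simp only [zero_mul, add_zero] at h
  refine h.norm.congr (Filter.Eventually.of_forall fun z ↦ ?_)
  simp only [Complex.norm_exp]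
  congr 1
  rw [show (-(b : ℂ) * ((‖z‖ : ℂ)) ^ 2) = ((-b * ‖z‖ ^ 2 : ℝ) : ℂ) by push_cast; ring]
  exact Complex.ofReal_re _

/-- **Normalisability of coercive radial actions.** For `K ≥ 0`, a continuous nonnegative kinetic
term `G` and a continuous single-site weight with `w(r) ≥ b r − a` (`b > 0`), the Boltzmann weight
`exp(−(K G(φ) + ∑_x w(‖φ x‖²)))` is Lebesgue integrable on `(Fin d → Fin n) → ℂ`: it is dominated
by the product Gaussian `∏_x e^{a} e^{−b ‖φ x‖²}`. [folklore] -/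
theorem integrable_exp_neg_of_coercive {K a b : ℝ} (hK : 0 ≤ K) (hb : 0 < b)
    {G : Config d n → ℝ} (hG : Continuous G) (hG0 : ∀ φ, 0 ≤ G φ)
    {w : ℝ → ℝ} (hw : Continuous w) (hcoer : ∀ r, 0 ≤ r → b * r - a ≤ w r) :
    Integrable fun φ : Config d n ↦ Real.exp (-(K * G φ + ∑ x, w (‖φ x‖ ^ 2))) := by
  -- the dominating product Gaussian
  have hg : Integrable (fun φ : Config d n ↦
      ∏ x : Fin d → Fin n, Real.exp a * Real.exp (-b * ‖φ x‖ ^ 2)) :=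
    Integrable.fintype_prod (f := fun (_ : Fin d → Fin n) (z : ℂ) ↦ Real.exp a * Real.exp (-b * ‖z‖ ^ 2))
      fun _ ↦ (integrable_exp_neg_mul_normSq hb).const_mul _
  have hcont : Continuous fun φ : Config d n ↦ Real.exp (-(K * G φ + ∑ x, w (‖φ x‖ ^ 2))) := by
    refine Real.continuous_exp.comp (Continuous.neg (Continuous.add (continuous_const.mul hG) ?_))
    exact continuous_finsetSum _ fun x _ ↦ hw.comp ((continuous_apply x).norm.pow 2)
  refine hg.mono' hcont.aestronglyMeasurable (Filter.Eventually.of_forall fun φ ↦ ?_)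
  rw [Real.norm_eq_abs, abs_of_pos (Real.exp_pos _)]
  -- pointwise domination
  have hsum : ∑ x : Fin d → Fin n, (b * ‖φ x‖ ^ 2 - a) ≤ ∑ x, w (‖φ x‖ ^ 2) :=
    sum_le_sum fun x _ ↦ hcoer _ (by positivity)
  have hprod : ∏ x : Fin d → Fin n, Real.exp a * Real.exp (-b * ‖φ x‖ ^ 2) =
      Real.exp (-∑ x : Fin d → Fin n, (b * ‖φ x‖ ^ 2 - a)) := by
    rw [← sum_neg_distrib, Real.exp_sum]
    refine prod_congr rfl fun x _ ↦ ?_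
    rw [← Real.exp_add]
    congr 1
    ring
  rw [hprod]
  apply Real.exp_le_exp.2
  have hKG : 0 ≤ K * G φ := mul_nonneg hK (hG0 φ)
  linarith

/-! ### Periodic boundary conditions: the torus `(ℤ/nℤ)^d` -/

section Periodic

variable [NeZero n]

/-- The periodic kinetic term `∑_x ∑_{k<d} ‖φ(x + e_k) − φ x‖²` (`x + e_k = x + Pi.single k 1`,
wrapping around in `Fin n`). [cite: FrohlichIsraelLiebSimon1978, §3 (nearest-neighbour coupling, periodic b.c.)] -/
def gradSq (φ : Config d n) : ℝ := ∑ x, ∑ k : Fin d, ‖φ (x + Pi.single k 1) - φ x‖ ^ 2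

/-- The action with stiffness `K` and a general single-site radial weight `w(‖φ_x‖²)`
(single-site a priori weight `e^{−w(|φ|²)} d²φ`): `K · gradSq φ + ∑_x w(‖φ x‖²)`.
[cite: FrohlichIsraelLiebSimon1978, §3 (single-site measure dϱ, nearest-neighbour Hamiltonian)] -/
def radialAction (K : ℝ) (w : ℝ → ℝ) (φ : Config d n) : ℝ := K * gradSq φ + ∑ x, w (‖φ x‖ ^ 2)

/-- **The lattice `φ⁴` action** `S(φ) = K ∑_x ∑_k ‖φ(x+e_k) − φ x‖² + K' ∑_x (‖φ x‖² − 1)²`.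
[cite: FrohlichSimonSpencer1976, §3–4 ((φ·φ)² lattice models)] -/
def phi4Action (K K' : ℝ) (φ : Config d n) : ℝ := radialAction K (phi4Weight K') φ

/-- The displayed formula for the `φ⁴` action. [folklore] -/
theorem phi4Action_eq (K K' : ℝ) (φ : Config d n) :
    phi4Action K K' φ =
      K * ∑ x, ∑ k : Fin d, ‖φ (x + Pi.single k 1) - φ x‖ ^ 2 +
        K' * ∑ x, (‖φ x‖ ^ 2 - 1) ^ 2 := by
  simp [phi4Action, radialAction, gradSq, phi4Weight, mul_sum]

/-- **`LatticePhi4Gibbs`**: the finite-volume lattice `φ⁴` Gibbs measure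
`Z⁻¹ exp(−S(φ)) ∏_x d²φ_x` on `(Fin d → Fin n) → ℂ`, periodic boundary conditions, stiffness `K`,
radial pinning `K'` (a probability measure for `K ≥ 0`, `K' > 0`:
`isProbabilityMeasure_latticePhi4Gibbs`). [cite: FrohlichSimonSpencer1976, §3–4 ((φ·φ)² lattice models)] -/
def latticePhi4Gibbs (d n : ℕ) [NeZero n] (K K' : ℝ) : Measure (Config d n) :=
  gibbsMeasure (phi4Action (d := d) (n := n) K K')

/-- The periodic Gibbs measure with a general radial single-site weight `w`.
[cite: FrohlichIsraelLiebSimon1978, §3 (Gibbs state of a nearest-neighbour model with single-site measure dϱ)] -/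
def latticeRadialGibbs (d n : ℕ) [NeZero n] (K : ℝ) (w : ℝ → ℝ) : Measure (Config d n) :=
  gibbsMeasure (radialAction (d := d) (n := n) K w)

/-- The kinetic term is nonnegative. [folklore] -/
theorem gradSq_nonneg (φ : Config d n) : 0 ≤ gradSq φ :=
  sum_nonneg fun _ _ ↦ sum_nonneg fun _ _ ↦ by positivity

/-- The kinetic term is continuous in the configuration. [folklore] -/
theorem continuous_gradSq : Continuous (gradSq : Config d n → ℝ) := by
  unfold gradSq
  fun_prop

/-- `e^{−S}` is integrable for the periodic radial action with a coercive continuous weight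
(`K ≥ 0`). [folklore] -/
theorem integrable_exp_neg_radialAction {K a b : ℝ} (hK : 0 ≤ K) (hb : 0 < b) {w : ℝ → ℝ}
    (hw : Continuous w) (hcoer : ∀ r, 0 ≤ r → b * r - a ≤ w r) :
    Integrable fun φ : Config d n ↦ Real.exp (-radialAction K w φ) :=
  integrable_exp_neg_of_coercive hK hb continuous_gradSq gradSq_nonneg hw hcoer

/-- **`Z(K, K', n) < ∞`**: `e^{−S}` is integrable for the `φ⁴` action with `K ≥ 0`, `K' > 0`.
[folklore] -/
theorem integrable_exp_neg_phi4Action {K K' : ℝ} (hK : 0 ≤ K) (hK' : 0 < K') :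
    Integrable fun φ : Config d n ↦ Real.exp (-phi4Action K K' φ) :=
  integrable_exp_neg_radialAction (a := K') hK (half_pos hK') (continuous_phi4Weight K')
    fun r _ ↦ phi4Weight_coercive hK'.le r

/-- **`Z(K, K', n) > 0`** for `K ≥ 0`, `K' > 0`. [folklore] -/
theorem partitionFunction_phi4Action_pos {K K' : ℝ} (hK : 0 ≤ K) (hK' : 0 < K') :
    0 < partitionFunction (phi4Action (d := d) (n := n) K K') :=
  partitionFunction_pos (integrable_exp_neg_phi4Action hK hK')

/-- **The lattice `φ⁴` Gibbs measure is a probability measure** (`K ≥ 0`, `K' > 0`).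
[folklore] -/
theorem isProbabilityMeasure_latticePhi4Gibbs {K K' : ℝ} (hK : 0 ≤ K) (hK' : 0 < K') :
    IsProbabilityMeasure (latticePhi4Gibbs d n K K') :=
  isProbabilityMeasure_gibbsMeasure (integrable_exp_neg_phi4Action hK hK')

/-- The periodic radial Gibbs measure is a probability measure for coercive continuous weights.
[folklore] -/
theorem isProbabilityMeasure_latticeRadialGibbs {K a b : ℝ} (hK : 0 ≤ K) (hb : 0 < b)
    {w : ℝ → ℝ} (hw : Continuous w) (hcoer : ∀ r, 0 ≤ r → b * r - a ≤ w r) :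
    IsProbabilityMeasure (latticeRadialGibbs d n K w) :=
  isProbabilityMeasure_gibbsMeasure (integrable_exp_neg_radialAction hK hb hw hcoer)

end Periodic

/-! ### Dirichlet wall: the field vanishes outside the cube `{0,…,n−1}^d` -/

/-- The forward neighbour value with a DIRICHLET wall: `φ(x + e_k)` if `x_k + 1 < n`, else `0`
(the field vanishes outside the cube `{0,…,n−1}^d`). [folklore] -/
def dirichletFwd (φ : Config d n) (x : Fin d → Fin n) (k : Fin d) : ℂ :=
  if h : (x k : ℕ) + 1 < n then φ (Function.update x k ⟨(x k : ℕ) + 1, h⟩) else 0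

/-- The Dirichlet kinetic term: all bonds with at least one endpoint in the cube, the field being
`0` outside — forward bonds `(x, x + e_k)` (leaving the cube when `x_k = n − 1`) and, for the face
`x_k = 0`, the bond entering from outside, which contributes `‖φ x − 0‖²`.
[folklore] -/
def dirichletGradSq (φ : Config d n) : ℝ :=
  ∑ x, ∑ k : Fin d, (‖dirichletFwd φ x k - φ x‖ ^ 2 + if (x k : ℕ) = 0 then ‖φ x‖ ^ 2 else 0)

/-- The `φ⁴` action with Dirichlet wall (`φ = 0` outside the cube), a Gibbs state with boundary
condition in the sense of Fröhlich–Israel–Lieb–Simon §3. [cite: FrohlichIsraelLiebSimon1978, §3 (Gibbs state with boundary condition ϱ_∂Λ)] -/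
def dirichletPhi4Action (K K' : ℝ) (φ : Config d n) : ℝ :=
  K * dirichletGradSq φ + ∑ x, phi4Weight K' (‖φ x‖ ^ 2)

/-- The `φ⁴` Gibbs measure with Dirichlet wall. [cite: FrohlichIsraelLiebSimon1978, §3 (Gibbs state with boundary condition ϱ_∂Λ)] -/
def latticePhi4DirichletGibbs (d n : ℕ) (K K' : ℝ) : Measure (Config d n) :=
  gibbsMeasure (dirichletPhi4Action (d := d) (n := n) K K')

/-- The Dirichlet kinetic term is nonnegative. [folklore] -/
theorem dirichletGradSq_nonneg (φ : Config d n) : 0 ≤ dirichletGradSq φ :=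
  sum_nonneg fun _ _ ↦ sum_nonneg fun _ _ ↦ by positivity

/-- The Dirichlet forward value is continuous in the configuration. [folklore] -/
theorem continuous_dirichletFwd (x : Fin d → Fin n) (k : Fin d) :
    Continuous fun φ : Config d n ↦ dirichletFwd φ x k := by
  unfold dirichletFwd
  split_ifs
  · fun_prop
  · exact continuous_const

/-- The Dirichlet kinetic term is continuous. [folklore] -/
theorem continuous_dirichletGradSq : Continuous (dirichletGradSq : Config d n → ℝ) := by
  unfold dirichletGradSq
  refine continuous_finsetSum _ fun x _ ↦ continuous_finsetSum _ fun k _ ↦ ?_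
  have h1 : Continuous fun φ : Config d n ↦ ‖dirichletFwd φ x k - φ x‖ ^ 2 :=
    ((continuous_dirichletFwd x k).sub (continuous_apply x)).norm.pow 2
  have h2 : Continuous fun φ : Config d n ↦ (if (x k : ℕ) = 0 then ‖φ x‖ ^ 2 else 0 : ℝ) := by
    split_ifs
    · fun_prop
    · exact continuous_const
  exact h1.add h2

/-- `e^{−S}` is integrable for the Dirichlet `φ⁴` action with `K ≥ 0`, `K' > 0`. [folklore] -/
theorem integrable_exp_neg_dirichletPhi4Action {K K' : ℝ} (hK : 0 ≤ K) (hK' : 0 < K') :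
    Integrable fun φ : Config d n ↦ Real.exp (-dirichletPhi4Action K K' φ) :=
  integrable_exp_neg_of_coercive (a := K') hK (half_pos hK') continuous_dirichletGradSq
    dirichletGradSq_nonneg (continuous_phi4Weight K') fun r _ ↦ phi4Weight_coercive hK'.le r

/-- The Dirichlet `φ⁴` Gibbs measure is a probability measure (`K ≥ 0`, `K' > 0`). [folklore] -/
theorem isProbabilityMeasure_latticePhi4DirichletGibbs {K K' : ℝ} (hK : 0 ≤ K) (hK' : 0 < K') :
    IsProbabilityMeasure (latticePhi4DirichletGibbs d n K K') :=
  isProbabilityMeasure_gibbsMeasure (integrable_exp_neg_dirichletPhi4Action hK hK')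

/-! ### Observables -/

/-- The two-point function `⟨conj(φ x) φ y⟩_μ`. [folklore] -/
def twoPoint (μ : Measure (Config d n)) (x y : Fin d → Fin n) : ℂ := ∫ φ, conj (φ x) * φ y ∂μ

/-- The long-range-order parameter `n^{−2d} ∑_x ∑_y Re ⟨conj(φ x) φ y⟩_μ = ⟨|n^{−d} ∑_x φ_x|²⟩`
(the square of the magnetisation per site, i.e. the weight of the zero Fourier mode).
[folklore] -/
def lroParameter (μ : Measure (Config d n)) : ℝ :=
  ((n : ℝ) ^ (2 * d))⁻¹ * ∑ x : Fin d → Fin n, ∑ y : Fin d → Fin n, (twoPoint μ x y).re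

end LatticePhi4

end Literature.Probability.LatticeModels

end
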